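import Summits.NavierStokesRegularity.NavierStokesRegularity.Theorems.HubbleDynamoNoSelfExcitedDynamoStubUniformlyRecurrentProfile
import Summits.NavierStokesRegularity.NavierStokesRegularity.Theorems.HubbleDynamoNoSelfExcitedDynamoNoRecurrentTypeIProfile
import Summits.NavierStokesRegularity.NavierStokesRegularity.Theorems.HubbleDynamoNoSelfExcitedDynamoOfTypeILiouvilleNode
import HarnessLib

/-!
# Crux `NoSelfExcitedDynamo` (stmt-NavierStokesRegularity-1934), line `registered` v13: the crux IS the
  non-existence of UNIFORMLY RECURRENT pointwise-Type-I profile flows — the pointwise twin of the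
  node crux `RecurrentLiouville`

Theorems file (lands `--supports stmt-NavierStokesRegularity-1934`; sub-goals
`eternalLiouville_of_noUniformlyRecurrentTypeIProfile`, `noSelfExcitedDynamo_of_noUniformlyRecurrentTypeIProfile`,
`noUniformlyRecurrentTypeIProfile_of_noSelfExcitedDynamo`,
`noUniformlyRecurrentTypeIProfile_iff_noRecurrentTypeIProfile`,
`noUniformlyRecurrentTypeIProfile_of_recurrentLiouville`). It makes precise the line's reshape v12/v13
(lead c2): the one open stub of the line,

  (G″) `stub_noUniformlyRecurrentTypeIProfile`: every eternal classical solution `(W, Q)` of Leray's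
       backward system `∂ₛW + ½W + ½(y·∇)W + (W·∇)W + ∇Q = ΔW`, `div W = 0` on `ℝ × ℝ³`
       (`IsBackwardLeraySolutionOn univ 1 W Q`) in the uniform profile class
       `(1 + ‖y‖)^{k+1}‖DᵏW(s, y)‖ ≤ K_k` which is UNIFORMLY RECURRENT under real similarity-time
       shifts, uniformly on compacts (for every `ε > 0`, `R` there is `L > 0` such that every window
       `[a, a + L]` contains `σ` with `‖W(s + σ, y) − W(s, y)‖ < ε` on `[−R, R] × B̄(0, R)` —
       Birkhoff almost periodicity, return shifts relatively dense in both time directions) vanishes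
       identically,

is EQUIVALENT to the crux and to the previous open stub (G′) (plain recurrence along integers):

* (G″) ⇒ crux (`noSelfExcitedDynamo_of_noUniformlyRecurrentTypeIProfile`): by the landed eternal
  Liouville reduction `stub_eternalReduction` (p151325) it suffices that every eternal profile-class
  solution vanishes (`eternalLiouville_of_noUniformlyRecurrentTypeIProfile`): if its amplitude is
  `δ`-small at arbitrarily early times for every `δ > 0` this is `stub_pastSmallnessLiouville`
  (p156442); otherwise some `δ > 0` is an amplitude floor on a past half-line, which the landed
  Birkhoff–Furstenberg stub `stub_uniformlyRecurrentProfile` (p160274) realises at EVERY time by a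
  UNIFORMLY RECURRENT eternal profile-class `W`; (G″) kills `W`, contradicting the floor.
* crux ⇒ (G″) (`noUniformlyRecurrentTypeIProfile_of_noSelfExcitedDynamo`): under the crux every eternal
  profile-class solution vanishes (`stub_eternalLiouvilleOfCrux` p152276 +
  `eternalLiouville_of_switchOff` p155533), recurrent or not.
* (G″) ⇔ (G′) (`noUniformlyRecurrentTypeIProfile_iff_noRecurrentTypeIProfile`) through the crux
  (`noSelfExcitedDynamo_of_noRecurrentTypeIProfile`, `noRecurrentTypeIProfile_of_noSelfExcitedDynamo`, p157861).
* The node implies (G″) (`noUniformlyRecurrentTypeIProfile_of_recurrentLiouville`): the RECURRENT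
  Liouville theorem `RecurrentLiouville` of the six-route Type-I Liouville node (stmt-1589: UNIFORMLY
  recurrent Type-I elements of the Albritton–Barker class — uniform recurrence of the scaling flow
  `σ ↦ nsRescale (e^σ) u`, i.e. of `σ ↦ U(· + 2σ, ·)` in similarity variables — are regular at the
  vertex) implies the crux (`noSelfExcitedDynamo_of_recurrentLiouville`, p157812), hence (G″): the
  open stub is the POINTWISE-DECAY TWIN of the node crux, with the same recurrence hypothesis.

## References

* H. Furstenberg, *Recurrence in Ergodic Theory and Combinatorial Number Theory* (1981), Ch. 1 §4,
  Thm 1.16 (uniformly recurrent points in compact invariant sets). [Furstenberg1981]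
* G. Koch, N. Nadirashvili, G. Seregin, V. Šverák, Acta Math. 203 (2009) = arXiv:0709.3599,
  Lemma 6.1, Thm 5.3. [KochNadirashviliSereginSverak2009]
* D. Chae, J. Wolf, arXiv:1610.09464, Thm 1.3; Z. Bradshaw, T.-P. Tsai, CPDE 2017, OP 5.1.
-/

noncomputable section

-- the mandated stub namespace repeats `NavierStokesRegularity` (tree precedent for this crux's stubs)
set_option linter.dupNamespace false

namespace Summit.NavierStokesRegularity.NavierStokesRegularity.Theorems.NoSelfExcitedDynamo.Registered

open Set MeasureTheory Filter Topology
open scoped ContDiff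
open Literature.Analysis.FluidPDE

/-- **Eternal Liouville from (G″)** (sub-goal `eternalLiouville_of_noUniformlyRecurrentTypeIProfile`):
if uniformly recurrent eternal profile-class solutions of Leray's backward system vanish, then EVERY
eternal profile-class solution vanishes. If its amplitude is `δ`-small at arbitrarily early times for
every `δ > 0`, `stub_pastSmallnessLiouville` applies; otherwise some `δ > 0` is an amplitude floor on a
past half-line, `stub_uniformlyRecurrentProfile` realises it at every time by a uniformly recurrent
eternal profile-class `W`, and (G″) makes `W ≡ 0` — contradicting the floor at time `0`. -/
theorem eternalLiouville_of_noUniformlyRecurrentTypeIProfile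
    (hG : ∀ (W : ℝ → EuclideanSpace ℝ (Fin 3) → EuclideanSpace ℝ (Fin 3)) (Q : ℝ → EuclideanSpace ℝ (Fin 3) → ℝ),
      IsBackwardLeraySolutionOn univ 1 W Q →
      (∀ k : ℕ, ∃ K : ℝ, ∀ s y, (1 + ‖y‖) ^ (k + 1) * ‖iteratedFDeriv ℝ k (W s) y‖ ≤ K) →
      (∀ ε : ℝ, 0 < ε → ∀ R : ℝ, ∃ L : ℝ, 0 < L ∧ ∀ a : ℝ, ∃ σ ∈ Icc a (a + L),
        ∀ s ∈ Icc (-R) R, ∀ y ∈ Metric.closedBall (0 : EuclideanSpace ℝ (Fin 3)) R,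
          ‖W (s + σ) y - W s y‖ < ε) →
      ∀ s y, W s y = 0)
    (U : ℝ → EuclideanSpace ℝ (Fin 3) → EuclideanSpace ℝ (Fin 3)) (P : ℝ → EuclideanSpace ℝ (Fin 3) → ℝ)
    (hL : IsBackwardLeraySolutionOn univ 1 U P)
    (hprof : ∀ k : ℕ, ∃ K : ℝ, ∀ s y, (1 + ‖y‖) ^ (k + 1) * ‖iteratedFDeriv ℝ k (U s) y‖ ≤ K) :
    ∀ s y, U s y = 0 := by
  refine stub_pastSmallnessLiouville U P hL hprof fun δ hδ S => ?_
  by_contra hcon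
  push Not at hcon
  obtain ⟨W, Q, hW, hWprof, hfloor, hrec⟩ :=
    stub_uniformlyRecurrentProfile U P hL hprof δ S hδ fun s hs => (hcon s hs).imp fun y hy => hy.le
  obtain ⟨y, hy⟩ := hfloor 0
  have h0 : W 0 y = 0 := hG W Q hW hWprof hrec 0 y
  rw [h0, norm_zero] at hy
  exact absurd hy (not_le.2 hδ)

/-- **(G″) ⇒ crux** (sub-goal `noSelfExcitedDynamo_of_noUniformlyRecurrentTypeIProfile`; the
conclusion is `NoSelfExcitedDynamo` written unfolded): no uniformly recurrent pointwise-Type-I profile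
flow implies the pointwise Type-I Liouville theorem, through `stub_eternalReduction` and
`eternalLiouville_of_noUniformlyRecurrentTypeIProfile`. This is the line's composition `compose` of
skeleton v13 as a tree theorem. -/
theorem noSelfExcitedDynamo_of_noUniformlyRecurrentTypeIProfile
    (hG : ∀ (W : ℝ → EuclideanSpace ℝ (Fin 3) → EuclideanSpace ℝ (Fin 3)) (Q : ℝ → EuclideanSpace ℝ (Fin 3) → ℝ),
      IsBackwardLeraySolutionOn univ 1 W Q →
      (∀ k : ℕ, ∃ K : ℝ, ∀ s y, (1 + ‖y‖) ^ (k + 1) * ‖iteratedFDeriv ℝ k (W s) y‖ ≤ K) →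
      (∀ ε : ℝ, 0 < ε → ∀ R : ℝ, ∃ L : ℝ, 0 < L ∧ ∀ a : ℝ, ∃ σ ∈ Icc a (a + L),
        ∀ s ∈ Icc (-R) R, ∀ y ∈ Metric.closedBall (0 : EuclideanSpace ℝ (Fin 3)) R,
          ‖W (s + σ) y - W s y‖ < ε) →
      ∀ s y, W s y = 0) :
    ∀ u : ℝ → EuclideanSpace ℝ (Fin 3) → EuclideanSpace ℝ (Fin 3),
      IsBoundedAncientMildSolution 1 u →
      (∀ t < 0, AEStronglyMeasurable (u t) volume) → (∃ C : ℝ, HasTypeIDecay C u) →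
      ∀ t < 0, u t =ᵐ[volume] (0 : EuclideanSpace ℝ (Fin 3) → EuclideanSpace ℝ (Fin 3)) :=
  stub_eternalReduction fun U P hL hprof _ => eternalLiouville_of_noUniformlyRecurrentTypeIProfile hG U P hL hprof

/-- **crux ⇒ (G″)** (sub-goal `noUniformlyRecurrentTypeIProfile_of_noSelfExcitedDynamo`; hypothesis
`NoSelfExcitedDynamo` written unfolded): under the crux every eternal profile-class solution vanishes
(`stub_eternalLiouvilleOfCrux` + `eternalLiouville_of_switchOff`), uniformly recurrent or not. -/
theorem noUniformlyRecurrentTypeIProfile_of_noSelfExcitedDynamo :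
    (∀ u : ℝ → EuclideanSpace ℝ (Fin 3) → EuclideanSpace ℝ (Fin 3),
      IsBoundedAncientMildSolution 1 u →
      (∀ t < 0, AEStronglyMeasurable (u t) volume) → (∃ C : ℝ, HasTypeIDecay C u) →
      ∀ t < 0, u t =ᵐ[volume] (0 : EuclideanSpace ℝ (Fin 3) → EuclideanSpace ℝ (Fin 3))) →
    ∀ (W : ℝ → EuclideanSpace ℝ (Fin 3) → EuclideanSpace ℝ (Fin 3)) (Q : ℝ → EuclideanSpace ℝ (Fin 3) → ℝ),
      IsBackwardLeraySolutionOn univ 1 W Q →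
      (∀ k : ℕ, ∃ K : ℝ, ∀ s y, (1 + ‖y‖) ^ (k + 1) * ‖iteratedFDeriv ℝ k (W s) y‖ ≤ K) →
      (∀ ε : ℝ, 0 < ε → ∀ R : ℝ, ∃ L : ℝ, 0 < L ∧ ∀ a : ℝ, ∃ σ ∈ Icc a (a + L),
        ∀ s ∈ Icc (-R) R, ∀ y ∈ Metric.closedBall (0 : EuclideanSpace ℝ (Fin 3)) R,
          ‖W (s + σ) y - W s y‖ < ε) →
      ∀ s y, W s y = 0 :=
  fun hcrux W Q hW hWprof _ =>
    eternalLiouville_of_switchOff (stub_eternalLiouvilleOfCrux hcrux) W Q hW hWprof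

/-- **(G″) ⇔ (G′)** (sub-goal `noUniformlyRecurrentTypeIProfile_iff_noRecurrentTypeIProfile`): the open
stub of skeleton v13 (uniformly recurrent flows, real shifts) and that of skeleton v11 (flows recurrent
along integers `n → ∞`) are equivalent — both are equivalent to the crux
(`noSelfExcitedDynamo_of_noUniformlyRecurrentTypeIProfile` / `noRecurrentTypeIProfile_of_noSelfExcitedDynamo`
and `noSelfExcitedDynamo_of_noRecurrentTypeIProfile` / `noUniformlyRecurrentTypeIProfile_of_noSelfExcitedDynamo`). -/
theorem noUniformlyRecurrentTypeIProfile_iff_noRecurrentTypeIProfile :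
    (∀ (W : ℝ → EuclideanSpace ℝ (Fin 3) → EuclideanSpace ℝ (Fin 3)) (Q : ℝ → EuclideanSpace ℝ (Fin 3) → ℝ),
      IsBackwardLeraySolutionOn univ 1 W Q →
      (∀ k : ℕ, ∃ K : ℝ, ∀ s y, (1 + ‖y‖) ^ (k + 1) * ‖iteratedFDeriv ℝ k (W s) y‖ ≤ K) →
      (∀ ε : ℝ, 0 < ε → ∀ R : ℝ, ∃ L : ℝ, 0 < L ∧ ∀ a : ℝ, ∃ σ ∈ Icc a (a + L),
        ∀ s ∈ Icc (-R) R, ∀ y ∈ Metric.closedBall (0 : EuclideanSpace ℝ (Fin 3)) R,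
          ‖W (s + σ) y - W s y‖ < ε) →
      ∀ s y, W s y = 0) ↔
    (∀ (W : ℝ → EuclideanSpace ℝ (Fin 3) → EuclideanSpace ℝ (Fin 3)) (Q : ℝ → EuclideanSpace ℝ (Fin 3) → ℝ),
      IsBackwardLeraySolutionOn univ 1 W Q →
      (∀ k : ℕ, ∃ K : ℝ, ∀ s y, (1 + ‖y‖) ^ (k + 1) * ‖iteratedFDeriv ℝ k (W s) y‖ ≤ K) →
      (∀ ε : ℝ, 0 < ε → ∀ (R : ℝ) (N : ℕ), ∃ n : ℕ, N ≤ n ∧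
        ∀ s ∈ Icc (-R) R, ∀ y ∈ Metric.closedBall (0 : EuclideanSpace ℝ (Fin 3)) R,
          ‖W (s + n) y - W s y‖ < ε) →
      ∀ s y, W s y = 0) :=
  ⟨fun hG => noRecurrentTypeIProfile_of_noSelfExcitedDynamo
      (noSelfExcitedDynamo_of_noUniformlyRecurrentTypeIProfile hG),
    fun hG' => noUniformlyRecurrentTypeIProfile_of_noSelfExcitedDynamo
      (noSelfExcitedDynamo_of_noRecurrentTypeIProfile hG')⟩

/-- **The node implies (G″)** (sub-goal `noUniformlyRecurrentTypeIProfile_of_recurrentLiouville`): the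
recurrent Type-I Liouville theorem `RecurrentLiouville` of the six-route node (stmt-1589; uniform
recurrence of the scaling flow in the Albritton–Barker time-rate class ⇒ regular vertex) implies the
crux (`noSelfExcitedDynamo_of_recurrentLiouville`), hence its pointwise twin (G″). -/
theorem noUniformlyRecurrentTypeIProfile_of_recurrentLiouville (h : Theses.SqueezeCycle.RecurrentLiouville) :
    ∀ (W : ℝ → EuclideanSpace ℝ (Fin 3) → EuclideanSpace ℝ (Fin 3)) (Q : ℝ → EuclideanSpace ℝ (Fin 3) → ℝ),
      IsBackwardLeraySolutionOn univ 1 W Q →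
      (∀ k : ℕ, ∃ K : ℝ, ∀ s y, (1 + ‖y‖) ^ (k + 1) * ‖iteratedFDeriv ℝ k (W s) y‖ ≤ K) →
      (∀ ε : ℝ, 0 < ε → ∀ R : ℝ, ∃ L : ℝ, 0 < L ∧ ∀ a : ℝ, ∃ σ ∈ Icc a (a + L),
        ∀ s ∈ Icc (-R) R, ∀ y ∈ Metric.closedBall (0 : EuclideanSpace ℝ (Fin 3)) R,
          ‖W (s + σ) y - W s y‖ < ε) →
      ∀ s y, W s y = 0 :=
  noUniformlyRecurrentTypeIProfile_of_noSelfExcitedDynamo (noSelfExcitedDynamo_of_recurrentLiouville h)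

end Summit.NavierStokesRegularity.NavierStokesRegularity.Theorems.NoSelfExcitedDynamo.Registered

end
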